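import Literature.NumberTheory.LFunctions.ZetaZerosProofs
import Mathlib.NumberTheory.Harmonic.EulerMascheroni
import Mathlib.Analysis.Real.Pi.Bounds
import Mathlib.Analysis.Complex.ExponentialBounds
import Mathlib.MeasureTheory.Integral.IntervalIntegral.Basic
import HarnessLib

/-!
# RH-FREE — Simonič's explicit Selberg-type zero-density estimate near the critical line and his explicit mean square of `ζ(½ + it)` («nothing here bears on the truth of RH»)

Topic `Literature/NumberTheory/LFunctions` (RH literature-typing tranche 1, L4 "explicit zero
statistics"). Label: **RH-FREE** — unconditional published theorems vendored as NAMED FACTS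
(`def … : Prop`, D-0014; nothing asserted, users take `(h : …)`), plus one cheap PROVED
consequence. Nothing here bears on the truth of RH. Companion of `ZetaZeroDensityExplicit.lean`
(Ingham-type explicit densities near `σ = 1`: Kadiri–Lumley–Ng, Fiori–Kadiri–Swidinsky,
Johnston–Yang); the present bounds are the ones "of interest only for `σ ∈ (1/2, 5/8]`" (source),
i.e. near the critical line (consumers: `S(t)` / pair-correlation budgets).

Source: A. Simonič, *Explicit zero density estimate for the Riemann zeta-function near the critical
line*, J. Math. Anal. Appl. **491** (2020) 124303 (arXiv:1910.08274), typed from the arXiv text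
`[corpus:paper:arxiv-1910.08274 p0003–p0004 (Thm. 1, displayed corollary, (1.5), (1.6)), p0012
(Cor. 5), p0020 (§4.5 proof of Thm. 1)]`:

* `Simonic2020_thm1` — **Theorem 1**: for `T ≥ H₀ = 3.0610046·10¹⁰` and `σ ∈ [1/2, 0.831]`,
  `N(σ, 2T) − N(σ, T) ≤ a T^{1−(σ−½)/4} log T + b log²T + c log T log log T + d log T`,
  `a = 10395.2`, `b = 1.104`, `c = 0.173`, `d = 0.51` (explicit form of Selberg 1946,
  `N(σ,T) ≪ T^{1−(σ−½)/4} log T`);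
* `Simonic2020_thm1_dyadic` — the **displayed corollary** after Theorem 1: for `T ≥ 2H₀`,
  `N(σ, T) ≤ 10395.21/(2^{1−(σ−½)/4} − 1) · T^{1−(σ−½)/4} log(T/2)`;
* `Simonic2020_eq15` — **(1.5)**: for `T ≥ 10⁵⁰` and `σ ∈ [1/2, 0.569]`,
  `N(σ, 2T) − N(σ, T) ≤ 5.357 T^{1−(σ−½)/4} log T + 1.11 log²T`;
* `Simonic2020_cor5` — **Corollary 5**: for `T ≥ 2π`,
  `∫₀ᵀ |ζ(½+it)|² dt ≤ T log T − (1 + log 2π − 2γ)T + 13.803 T^{3/4}√(log(T/2π)) + 83.964 √T log(T/2π)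
  + 2·10³ log T + 3691.24` (the source states `𝓔(T) ≤ …` for the remainder `𝓔` of Littlewood's
  asymptotic; `γ` = Euler–Mascheroni);
* `Simonic2020_meanSquare_2000` — **(1.6)** (§1): for `T ≥ 2000`,
  `∫₀ᵀ |ζ(½+it)|² dt ≤ T log T − (1 + log 2π − 2γ)T + 70.26 T^{3/4} √(log(T/2π))`.

## Conventions (equivalence with the printed statements)

The source's `N(T)` counts `γ ∈ (0, T]` (as the tree's `zetaZeroCount`) and `N(σ, T)` "those
zeros with `β > σ ≥ 1/2`" (OPEN in `σ`, with multiplicity). The tree's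
`zetaZeroCountRe σ T` is CLOSED in `σ` (`β ≥ σ`, `0 < γ ≤ T`), so each printed statement about
`N(σ, ·)` is typed, EQUIVALENTLY (the zeros in a bounded box are finitely many: take `σ' = min β`),
as the same bound for `zetaZeroCountRe σ' ·` for every `σ' > σ`; the difference
`zetaZeroCountRe σ' (2T) − zetaZeroCountRe σ' T` is exactly `#{β ≥ σ', T < γ ≤ 2T}` (nested boxes).
Real powers are `Real.rpow`; `H₀` is the numeral of the source (Platt's RH height).

Proved here: `Simonic2020_cor5.le_main_add` (dropping the negative term `−(1 + log 2π − 2γ)T`, using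
Mathlib's `Real.eulerMascheroniConstant_lt_two_thirds`). Deliberately NOT here: the explicit
approximate functional equations (Thm. 4, Cors. 1–3), Selberg's weighted moment (Thm. 7), the
zero-detecting Proposition 1 — the machinery of the proof.

## References

* A. Simonič, J. Math. Anal. Appl. 491 (2020) 124303, Thm. 1, (1.5), (1.6), Cor. 5
  (arXiv:1910.08274). [Simonic2020]
* A. Selberg, *Contributions to the theory of the Riemann zeta-function*, Arch. Math. Naturvid. 48
  (1946) no. 5 (the inexplicit `N(σ,T) ≪ T^{1−(σ−½)/4} log T`).
* E. C. Titchmarsh, *The Theory of the Riemann Zeta-Function*, 2nd ed., Thm. 9.19(C), §7.3–7.4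
  (Littlewood's mean square). [Titchmarsh1986]
-/

noncomputable section

open Real MeasureTheory intervalIntegral

namespace Literature.NumberTheory.LFunctions

namespace Simonic2020

/-- Platt's RH-verification height used by the source: `H₀ := 3.0610046·10¹⁰` (§1).
[cite: Simonic2020, §1 (definition of H₀)] -/
def H₀ : ℝ := 30610046000

/-- Selberg's exponent `1 − (σ − ½)/4`. [cite: Simonic2020, Thm. 1] -/
def selbergExponent (σ : ℝ) : ℝ := 1 - (σ - 1 / 2) / 4

end Simonic2020

/-- NAMED FACT (Simonič 2020, **Theorem 1**, as printed: "Let `T ≥ H₀` and `σ ∈ [1/2, 0.831]`.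
Then we have `N(σ,2T) − N(σ,T) ≤ a T^{1−¼(σ−½)} log T + b log²T + c log T log log T + d log T`, with
`a = 10395.2`, `b = 1.104`, `c = 0.173` and `d = 0.51`", `H₀ = 3.0610046·10¹⁰`). An explicit form of
Selberg's zero-density estimate near the critical line. The source's `N(σ, ·)` counts `β > σ`
(open), hence the quantifier `∀ σ' > σ` over the tree's closed `zetaZeroCountRe` (equivalent, module
docstring). Unconditional. Users take `(h : Simonic2020_thm1)`. [cite: Simonic2020, Thm. 1] -/
def Simonic2020_thm1 : Prop :=
  ∀ σ σ' T : ℝ, 1 / 2 ≤ σ → σ ≤ 0.831 → σ < σ' → Simonic2020.H₀ ≤ T →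
    (zetaZeroCountRe σ' (2 * T) : ℝ) - zetaZeroCountRe σ' T ≤
      10395.2 * T ^ Simonic2020.selbergExponent σ * Real.log T + 1.104 * Real.log T ^ 2
        + 0.173 * Real.log T * Real.log (Real.log T) + 0.51 * Real.log T

/-- NAMED FACT (Simonič 2020, the corollary displayed after Theorem 1, as printed: "Under the
assumptions of Theorem 1, an immediate corollary is
`N(σ,T) ≤ 10395.21/(2^{1−¼(σ−½)} − 1) · T^{1−¼(σ−½)} log(T/2)` for `T ≥ 2H₀`" (dyadic summation of
Theorem 1), `σ ∈ [1/2, 0.831]`). Same reading of `N(σ, ·)` (`∀ σ' > σ`). Unconditional. Users take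
`(h : Simonic2020_thm1_dyadic)`. [cite: Simonic2020, §1 (display after Thm. 1)] -/
def Simonic2020_thm1_dyadic : Prop :=
  ∀ σ σ' T : ℝ, 1 / 2 ≤ σ → σ ≤ 0.831 → σ < σ' → 2 * Simonic2020.H₀ ≤ T →
    (zetaZeroCountRe σ' T : ℝ) ≤
      10395.21 / (2 ^ Simonic2020.selbergExponent σ - 1) * T ^ Simonic2020.selbergExponent σ
        * Real.log (T / 2)

/-- NAMED FACT (Simonič 2020, eq. **(1.5)**, as printed: "for `T ≥ 10⁵⁰` and `σ ∈ [1/2, 0.569]` we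
have `N(σ,2T) − N(σ,T) ≤ 5.357 · T^{1−¼(σ−½)} log T + 1.11 · log²T`" (from the proof of Theorem 1
with `T₀ = 10⁵⁰`, `σ₁ = 2.4`; "with the method presented here we cannot get a smaller constant than
`3.259`")). Same reading of `N(σ, ·)`. Unconditional. Users take `(h : Simonic2020_eq15)`.
[cite: Simonic2020, §1 eq. (1.5) and §4.5] -/
def Simonic2020_eq15 : Prop :=
  ∀ σ σ' T : ℝ, 1 / 2 ≤ σ → σ ≤ 0.569 → σ < σ' → (10 : ℝ) ^ 50 ≤ T →
    (zetaZeroCountRe σ' (2 * T) : ℝ) - zetaZeroCountRe σ' T ≤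
      5.357 * T ^ Simonic2020.selbergExponent σ * Real.log T + 1.11 * Real.log T ^ 2

/-- NAMED FACT (Simonič 2020, **Corollary 5**, as printed: "Let `T ≥ 2π`. Then
`𝓔(T) ≤ 13.803 T^{3/4} √(log(T/2π)) + 83.964 √T log(T/2π) + 2·10³ log T + 3691.24`", where
`∫₀ᵀ |ζ(½+it)|² dt = T log T − (1 + log 2π − 2γ)T + 𝓔(T)` defines `𝓔` (Littlewood's mean-square
asymptotic; `γ` the Euler–Mascheroni constant, Mathlib's `Real.eulerMascheroniConstant`)). Typed with
`𝓔(T)` unfolded. Unconditional. Users take `(h : Simonic2020_cor5)`. [cite: Simonic2020, Cor. 5] -/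
def Simonic2020_cor5 : Prop :=
  ∀ T : ℝ, 2 * π ≤ T →
    ∫ t in (0 : ℝ)..T, ‖riemannZeta (1 / 2 + t * Complex.I)‖ ^ 2 ≤
      T * Real.log T - (1 + Real.log (2 * π) - 2 * Real.eulerMascheroniConstant) * T
        + (13.803 * T ^ (3 / 4 : ℝ) * Real.sqrt (Real.log (T / (2 * π)))
          + 83.964 * Real.sqrt T * Real.log (T / (2 * π)) + 2000 * Real.log T + 3691.24)

/-- NAMED FACT (Simonič 2020, §1 eq. **(1.6)**, as printed: "an explicit upper bound for the second
power moment of `ζ(s)` on the critical line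
`∫₀ᵀ |ζ(½+it)|² dt ≤ T log T − (1 + log 2π − 2γ)T + 70.26 · T^{3/4} √(log(T/2π))`, valid for
`T ≥ 2000`, see Corollary 5 for a more precise statement"). Unconditional. Users take
`(h : Simonic2020_meanSquare_2000)`. [cite: Simonic2020, §1 eq. (1.6)] -/
def Simonic2020_meanSquare_2000 : Prop :=
  ∀ T : ℝ, 2000 ≤ T →
    ∫ t in (0 : ℝ)..T, ‖riemannZeta (1 / 2 + t * Complex.I)‖ ^ 2 ≤
      T * Real.log T - (1 + Real.log (2 * π) - 2 * Real.eulerMascheroniConstant) * T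
        + 70.26 * T ^ (3 / 4 : ℝ) * Real.sqrt (Real.log (T / (2 * π)))

/-! ## Elementary consequences (proved) -/

/-- `1 + log 2π − 2γ > 0` (`γ < 2/3` and `log 2π ≥ 1` since `2π > 6 > e`). [folklore] -/
private theorem littlewood_coeff_pos : 0 < 1 + Real.log (2 * π) - 2 * Real.eulerMascheroniConstant := by
  have hγ := Real.eulerMascheroniConstant_lt_two_thirds
  have he : Real.exp 1 ≤ 2 * π := by
    have h1 := Real.exp_one_lt_d9
    have h2 := Real.pi_gt_three
    linarith
  have hπ : 1 ≤ Real.log (2 * π) := by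
    rw [Real.le_log_iff_exp_le (by positivity)]
    exact he
  linarith

namespace Simonic2020_cor5

/-- Dropping the negative secondary main term: for `T ≥ 2π`,
`∫₀ᵀ |ζ(½+it)|² dt ≤ T log T + 13.803 T^{3/4} √(log(T/2π)) + 83.964 √T log(T/2π) + 2000 log T + 3691.24`.
[cite: Simonic2020, Cor. 5] -/
theorem le_main_add (h : Simonic2020_cor5) {T : ℝ} (hT : 2 * π ≤ T) :
    ∫ t in (0 : ℝ)..T, ‖riemannZeta (1 / 2 + t * Complex.I)‖ ^ 2 ≤
      T * Real.log T + (13.803 * T ^ (3 / 4 : ℝ) * Real.sqrt (Real.log (T / (2 * π)))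
        + 83.964 * Real.sqrt T * Real.log (T / (2 * π)) + 2000 * Real.log T + 3691.24) := by
  have hT0 : 0 ≤ T := le_trans (by positivity) hT
  have hneg : 0 ≤ (1 + Real.log (2 * π) - 2 * Real.eulerMascheroniConstant) * T :=
    mul_nonneg littlewood_coeff_pos.le hT0
  linarith [h T hT]

end Simonic2020_cor5

namespace Simonic2020_meanSquare_2000

/-- Dropping the negative secondary main term: for `T ≥ 2000`,
`∫₀ᵀ |ζ(½+it)|² dt ≤ T log T + 70.26 T^{3/4} √(log(T/2π))`. [cite: Simonic2020, §1 eq. (1.6)] -/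
theorem le_main_add (h : Simonic2020_meanSquare_2000) {T : ℝ} (hT : 2000 ≤ T) :
    ∫ t in (0 : ℝ)..T, ‖riemannZeta (1 / 2 + t * Complex.I)‖ ^ 2 ≤
      T * Real.log T + 70.26 * T ^ (3 / 4 : ℝ) * Real.sqrt (Real.log (T / (2 * π))) := by
  have hT0 : 0 ≤ T := le_trans (by norm_num) hT
  have hneg : 0 ≤ (1 + Real.log (2 * π) - 2 * Real.eulerMascheroniConstant) * T :=
    mul_nonneg littlewood_coeff_pos.le hT0
  linarith [h T hT]

end Simonic2020_meanSquare_2000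

namespace Simonic2020_thm1

/-- At `σ = 1/2` the exponent is `1`: Theorem 1 bounds the number of zeros OFF the critical line
(`β ≥ σ' > ½`) with `T < γ ≤ 2T` by `10395.2 T log T + 1.104 log²T + 0.173 log T log log T + 0.51 log T`
for `T ≥ H₀`. [cite: Simonic2020, Thm. 1 (σ = 1/2)] -/
theorem off_line (h : Simonic2020_thm1) {σ' T : ℝ} (hσ' : 1 / 2 < σ') (hT : Simonic2020.H₀ ≤ T) :
    (zetaZeroCountRe σ' (2 * T) : ℝ) - zetaZeroCountRe σ' T ≤
      10395.2 * T * Real.log T + 1.104 * Real.log T ^ 2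
        + 0.173 * Real.log T * Real.log (Real.log T) + 0.51 * Real.log T := by
  have h1 := h (1 / 2) σ' T le_rfl (by norm_num) hσ' hT
  have he : Simonic2020.selbergExponent (1 / 2) = 1 := by
    unfold Simonic2020.selbergExponent; norm_num
  rw [he, Real.rpow_one] at h1
  exact h1

end Simonic2020_thm1

end Literature.NumberTheory.LFunctions

end
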